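import Mathlib

/-!
# B10 (69) from B7 (50): the bookkeeping of the `j`-fold iteration

Reproduction (statement-level, abstract) of the two unprinted bookkeeping facts behind Balaban, *Ultraviolet stability of
three-dimensional lattice pure gauge field theories*, Comm. Math. Phys. 102 (1985) 255–275, (69) p. 273 («Applying the
inequalities (50), (53) [4], we have |Ū^j_k(∂p′) − 1| < Σ_{x∈B^j(x₀)} L^{−3j} Σ_{p⊂(p′)_x} |U_k(∂p) − 1| + O(1)(g_jp(g_j))²»),
where [4] = Balaban, *Averaging operations for lattice gauge theories*, CMP 98 (1985) 17–51: (50) p. 25 is the ONE-STEP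
inequality (one block `B(y₀)`, weight `L^{−d}`, sub-plaquettes of the translates `(p′)_x`, remainder `O(1)(L²α₀)²`) and (53)
p. 26 is the `j`-fold SMALLNESS bound (no sum).  (69) is the `j`-fold LINEAR iteration of (50), which needs

1. the translates of translates to reassemble into the block `B^j(x₀)` with the uniform weight `L^{−dj}` — the base-`L`
   digit decomposition of the block (`block_sum_eq_nested`), and
2. the remainder of level `i − 1`, entering under the level-`i` sum, to be amplified by the `L²` sub-plaquettes of a
   translated big plaquette; with the level bounds of (53)/(54) (`a_{i−1} ≤ 2α₀L^{2(i−1)}η²`, `η = L^{−j}`) the amplified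
   remainders `L^{2(j−i)}·C₀(L²a_{i−1})²` still sum to `≤ (L²/(L²−1))·4C₀α₀²` (`amplified_remainder_le`).

Neither fact is printed in [4] or in B10; both are elementary.  Cell GAPS C-adv8-37.  Engines for the constant:
`eq69_engine.py` (exact rationals) and an awk re-run, folder of referee-b2b-balaban-adv8-g24-0.
[cite: Balaban1985UV3, (68)–(70) p.273; Balaban1985Averaging, (50) p.25, (52)–(54) p.26]
-/

namespace Literature.MathematicalPhysics.QuantumFieldTheory.Balaban1983to89.B10Eq69Iteration

open Finset

/-- **Amplified remainders.** `e i` = the accumulated remainder after `i` levels of iterating (50) towards scale `j`: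
`e 0 ≤ 0` and `e (i+1) ≤ L² · e i + K · L^{4(i+1)} / L^{4j}` for `i < j` (the term `K L^{4(i+1)−4j}` is
`C₀(L² a_i)²` with `a_i ≤ 2α₀L^{2i}L^{−2j}`, `K = 4C₀α₀²`; the factor `L²` is the number of sub-plaquettes of a translated
big plaquette).  Invariant: `e i ≤ K · L^{4i}/L^{4j} · L²/(L²−1)`. [cite: Balaban1985Averaging, (50) p.25, (53) p.26] -/
theorem amplified_remainder_invariant (L K : ℝ) (hL : 2 ≤ L) (hK : 0 ≤ K) (j : ℕ) (e : ℕ → ℝ)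
    (h0 : e 0 ≤ 0)
    (hstep : ∀ i, i < j → e (i + 1) ≤ L ^ 2 * e i + K * L ^ (4 * (i + 1)) / L ^ (4 * j)) :
    ∀ i, i ≤ j → e i ≤ K * L ^ (4 * i) / L ^ (4 * j) * (L ^ 2 / (L ^ 2 - 1)) := by
  have hL1 : 1 < L ^ 2 := by nlinarith
  have hLpos : 0 < L := by linarith
  have hLj : 0 < L ^ (4 * j) := pow_pos hLpos _
  have hden : 0 < L ^ 2 - 1 := by linarith
  intro i
  induction i with
  | zero =>
    intro _
    have : 0 ≤ K * L ^ (4 * 0) / L ^ (4 * j) * (L ^ 2 / (L ^ 2 - 1)) := by positivity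
    exact h0.trans this
  | succ i ih =>
    intro hi
    have hi' : i ≤ j := Nat.le_of_succ_le hi
    have h1 := hstep i (Nat.lt_of_succ_le hi)
    have h2 := ih hi'
    have hpow : L ^ (4 * (i + 1)) = L ^ (4 * i) * L ^ 4 := by
      rw [← pow_add]; ring_nf
    -- e (i+1) ≤ L² · (K L^{4i}/L^{4j} · L²/(L²−1)) + K L^{4i} L⁴ / L^{4j}
    --        = K L^{4i} L⁴/L^{4j} · (1/(L²−1) + 1) = K L^{4(i+1)}/L^{4j} · L²/(L²−1)
    have hKpow : 0 ≤ K * L ^ (4 * i) / L ^ (4 * j) := by positivity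
    have key : L ^ 2 * (K * L ^ (4 * i) / L ^ (4 * j) * (L ^ 2 / (L ^ 2 - 1)))
        + K * L ^ (4 * (i + 1)) / L ^ (4 * j)
        = K * L ^ (4 * (i + 1)) / L ^ (4 * j) * (L ^ 2 / (L ^ 2 - 1)) := by
      rw [hpow]
      field_simp
      ring
    calc e (i + 1) ≤ L ^ 2 * e i + K * L ^ (4 * (i + 1)) / L ^ (4 * j) := h1
      _ ≤ L ^ 2 * (K * L ^ (4 * i) / L ^ (4 * j) * (L ^ 2 / (L ^ 2 - 1)))
            + K * L ^ (4 * (i + 1)) / L ^ (4 * j) := by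
          have : 0 ≤ L ^ 2 := by positivity
          nlinarith
      _ = _ := key

/-- **The remainder of (69).** After `j` levels the accumulated remainder is `≤ K · L²/(L²−1) ≤ (4/3) K`; with `K = 4C₀α₀²`
and `α₀ = O(1)g_jp(g_j)` from B10 (68) this is the `O(1)(g_jp(g_j))²` of (69). [cite: Balaban1985UV3, (69) p.273] -/
theorem amplified_remainder_le (L K : ℝ) (hL : 2 ≤ L) (hK : 0 ≤ K) (j : ℕ) (e : ℕ → ℝ)
    (h0 : e 0 ≤ 0)
    (hstep : ∀ i, i < j → e (i + 1) ≤ L ^ 2 * e i + K * L ^ (4 * (i + 1)) / L ^ (4 * j)) :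
    e j ≤ K * (L ^ 2 / (L ^ 2 - 1)) ∧ K * (L ^ 2 / (L ^ 2 - 1)) ≤ 4 / 3 * K := by
  have hLpos : 0 < L := by linarith
  have h := amplified_remainder_invariant L K hL hK j e h0 hstep j le_rfl
  have hne : L ^ (4 * j) ≠ 0 := (pow_pos hLpos _).ne'
  refine ⟨?_, ?_⟩
  · have : K * L ^ (4 * j) / L ^ (4 * j) = K := by field_simp
    rw [this] at h; exact h
  · have hden : 0 < L ^ 2 - 1 := by nlinarith
    have hq : L ^ 2 / (L ^ 2 - 1) ≤ 4 / 3 := by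
      rw [div_le_iff₀ hden]; nlinarith
    calc K * (L ^ 2 / (L ^ 2 - 1)) ≤ K * (4 / 3) := mul_le_mul_of_nonneg_left hq hK
      _ = 4 / 3 * K := by ring

/-- **Digit decomposition of the block.** The block `B^j(x₀)` of the `L^j`-lattice in `d` dimensions, indexed by
`Fin d → Fin (L ^ j)`, is in bijection with the nested offsets `Fin d → Fin j → Fin L` (one base-`L` digit per level), so a
sum over the block is the `j`-fold nested sum over the one-step blocks; with weight `(L^{−d})^j = L^{−dj}` per point this is
the summation domain and weight of (69). Mathlib's `finFunctionFinEquiv`. [cite: Balaban1985UV3, (69) p.273] -/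
theorem block_sum_eq_nested (d j L : ℕ) (f : (Fin d → Fin (L ^ j)) → ℝ) :
    ∑ x, f x = ∑ g : Fin d → (Fin j → Fin L), f (fun μ => finFunctionFinEquiv (g μ)) := by
  let e : (Fin d → (Fin j → Fin L)) ≃ (Fin d → Fin (L ^ j)) :=
    Equiv.piCongrRight fun _ => finFunctionFinEquiv
  rw [← e.sum_comp]
  rfl

/-- The uniform weight: `(L^{−d})^j = L^{−dj}` ((69)'s `L^{−3j}` at `d = 3`). [cite: Balaban1985UV3, (69) p.273] -/
theorem weight_nested (L : ℝ) (d j : ℕ) : ((L ^ d)⁻¹) ^ j = (L ^ (d * j))⁻¹ := by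
  rw [pow_mul, inv_pow]

end Literature.MathematicalPhysics.QuantumFieldTheory.Balaban1983to89.B10Eq69Iteration
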